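import Summits.AtomisticToContinuum.Crystallization.Theorems.FreeSplittingCertificatesRadiusLadderJointSound
import Summits.AtomisticToContinuum.Crystallization.Theorems.FreeSplittingCertificatesRadiusLadderJointGeometry
import Summits.AtomisticToContinuum.Crystallization.Theorems.FreeSplittingCertificatesRadiusLadderHarmonics67
import Summits.AtomisticToContinuum.Crystallization.Theorems.FreeSplittingCertificatesRadiusLadderPacking

/-!
# Joint multi-shell certificates — from a certificate table to a site bound (`FiniteRangeSplitting`, stmt-AtomisticToContinuum-12559)

Support theorem for the next rung of the `FreeSplittingCertificates` radius ladder (block-2b unit `b2b-freesplit-A`, gen 40).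
VALUE = the geometric instantiation of the abstract soundness theorem `jointCert_sound` (matrix-valued Delsarte certificate,
arXiv:1206.2608 Thm 1.2 style, with radial cells) — NOT summit progress.

Given radial cell edges `δ = e 0 < e 1 < … < e n`, a kernel table `G k` over Legendre degrees `deg k ≤ 7` (the tree's closed-form
addition theorems `legPℓ_inner_eq`), the bordered inequality, factorised `G k` (`k ≥ 1`), the OFF sign conditions as univariate
polynomial facts on `[-1, min(1, c̄(i,i'))]` (`c̄` = `cbar4`, the corner maximum of the law of cosines), ball-count multipliers and the
diagonal condition with cell weights `w` majorising a radial function `φ`, every `δ`-separated configuration satisfies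
`∑_{j ≠ i, |x_i - x_j| < e n} φ(|x_i − x_j|) ≤ β₀ + ∑_q λ_q m_q` at every site `i`.
-/

noncomputable section

open Finset

namespace Summit.AtomisticToContinuum.Crystallization.Theorems.StrictSplittingRuleBirth

open Literature.MathematicalPhysics.StatisticalMechanics

/-! ## The Legendre family by degree and its positive definiteness on `S²` -/

/-- `P_d` for `d ≤ 7` (the degrees with a closed-form addition theorem in the tree); the constant kernel `1` otherwise. -/
def legPn : ℕ → ℝ → ℝ
  | 0 => fun _ => 1
  | 1 => legP1
  | 2 => legP2
  | 3 => legP3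
  | 4 => legP4
  | 5 => legP5
  | 6 => legP6
  | 7 => legP7
  | _ + 8 => fun _ => 1

/-- `P_d(1) = 1`. -/
theorem legPn_one (d : ℕ) : legPn d 1 = 1 := by
  rcases d with _ | _ | _ | _ | _ | _ | _ | _ | d
  · rfl
  · norm_num [legPn, legP1]
  · norm_num [legPn, legP2]
  · norm_num [legPn, legP3]
  · norm_num [legPn, legP4]
  · norm_num [legPn, legP5]
  · norm_num [legPn, legP6]
  · norm_num [legPn, legP7]
  · rfl

/-- `legPn 0` is the constant kernel. -/
theorem legPn_zero (t : ℝ) : legPn 0 t = 1 := rfl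

/-- From a weighted addition formula `P(⟪x,y⟫) = ∑ λ_m h_m(x) h_m(y)` (`λ ≥ 0`) to weighted positive definiteness. -/
theorem pd_of_addition {M : ℕ} (P : ℝ → ℝ) (lam : Fin M → ℝ) (h : Fin M → EuclideanSpace ℝ (Fin 3) → ℝ)
    (hlam : ∀ m, 0 ≤ lam m)
    (hP : ∀ x y : EuclideanSpace ℝ (Fin 3), ‖x‖ = 1 → ‖y‖ = 1 → P (inner ℝ x y) = ∑ m, lam m * h m x * h m y)
    {ι : Type*} [Fintype ι] (u : ι → EuclideanSpace ℝ (Fin 3)) (hu : ∀ j, ‖u j‖ = 1) (a : ι → ℝ) :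
    0 ≤ ∑ j, ∑ j', a j * a j' * P (inner ℝ (u j) (u j')) := by
  refine sum_sum_nonneg_of_gram Finset.univ (fun j j' => a j * a j' * P (inner ℝ (u j) (u j'))) lam
    (fun m j => a j * h m (u j)) hlam ?_
  intro j _ j' _
  rw [hP (u j) (u j') (hu j) (hu j'), Finset.mul_sum]
  exact Finset.sum_congr rfl fun m _ => by ring

/-- **Weighted positive definiteness of `P_d` on unit vectors** (`d` arbitrary: closed forms for `d ≤ 7`, constant otherwise). -/
theorem legPn_pd (d : ℕ) {ι : Type*} [Fintype ι] (u : ι → EuclideanSpace ℝ (Fin 3)) (hu : ∀ j, ‖u j‖ = 1)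
    (a : ι → ℝ) : 0 ≤ ∑ j, ∑ j', a j * a j' * legPn d (inner ℝ (u j) (u j')) := by
  have hconst : 0 ≤ ∑ j, ∑ j', a j * a j' * (1 : ℝ) := by
    simp_rw [mul_one, ← Finset.mul_sum, ← Finset.sum_mul]; exact mul_self_nonneg _
  rcases d with _ | _ | _ | _ | _ | _ | _ | _ | d
  · exact hconst
  · exact pd_of_addition legP1 lam1 harm1 (fun m => by fin_cases m <;> norm_num [lam1]) legP1_inner_eq u hu a
  · exact pd_of_addition legP2 lam2 harm2 (fun m => by fin_cases m <;> norm_num [lam2]) legP2_inner_eq u hu a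
  · exact pd_of_addition legP3 lam3 harm3 (fun m => by fin_cases m <;> norm_num [lam3]) legP3_inner_eq u hu a
  · exact pd_of_addition legP4 lam4 harm4 (fun m => by fin_cases m <;> norm_num [lam4]) legP4_inner_eq u hu a
  · exact pd_of_addition legP5 lam5 harm5 (fun m => by fin_cases m <;> norm_num [lam5]) legP5_inner_eq u hu a
  · exact pd_of_addition legP6 lam6 harm6 (fun m => by fin_cases m <;> norm_num [lam6]) legP6_inner_eq u hu a
  · exact pd_of_addition legP7 lam7 harm7 (fun m => by fin_cases m <;> norm_num [lam7]) legP7_inner_eq u hu a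
  · exact hconst

/-! ## Cells -/

/-- Monotonicity of strictly increasing edges on `0..n`. -/
theorem edges_mono {e : ℕ → ℝ} {n : ℕ} (hmono : ∀ k, k < n → e k < e (k + 1)) :
    ∀ k l, k ≤ l → l ≤ n → e k ≤ e l := by
  intro k l hkl hln
  induction l, hkl using Nat.le_induction with
  | base => exact le_rfl
  | succ l hkl ih => exact (ih (Nat.le_of_succ_le hln)).trans (hmono l (Nat.lt_of_succ_le hln)).le

/-- The cell of a radius `r ≥ e 0`: the largest `k ≤ n - 1` with `e k ≤ r`. -/
def cellOf (e : ℕ → ℝ) (n : ℕ) (r : ℝ) : ℕ := Nat.findGreatest (fun k => e k ≤ r) (n - 1)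

/-- The cell index is at most `n - 1`. -/
theorem cellOf_le (e : ℕ → ℝ) (n : ℕ) (r : ℝ) : cellOf e n r ≤ n - 1 := Nat.findGreatest_le _

/-- The lower edge of the cell of `r` is `≤ r` (given `e 0 ≤ r`). -/
theorem edge_cellOf_le {e : ℕ → ℝ} {n : ℕ} {r : ℝ} (h0 : e 0 ≤ r) : e (cellOf e n r) ≤ r := by
  classical
  exact Nat.findGreatest_spec (P := fun k => e k ≤ r) (Nat.zero_le _) h0

/-- `r` lies below the upper edge of its cell (given `r < e n`). -/
theorem lt_edge_cellOf_succ {e : ℕ → ℝ} {n : ℕ} {r : ℝ} (hn : 0 < n) (hr : r < e n) :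
    r < e (cellOf e n r + 1) := by
  classical
  by_cases h : cellOf e n r + 1 ≤ n - 1
  · have := Nat.findGreatest_is_greatest (P := fun k => e k ≤ r) (Nat.lt_succ_self _) h
    exact lt_of_not_ge this
  · have : cellOf e n r = n - 1 := le_antisymm (cellOf_le e n r) (by omega)
    rw [this, Nat.sub_add_cancel hn]
    exact hr

/-! ## The site bound -/

/-- **From a joint multi-shell certificate table to a site bound.**  See the module docstring; `φ` is any radial
function majorised cellwise by `w`, the count multipliers live on cell sets `S q` contained in `{cells < top q}` with
capacities `m q ≥ (2 e(top q)/δ + 1)³ − 1` (ball packing). -/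
theorem site_sum_le_of_jointCert {n L Q : ℕ} {μ : Type*} [Fintype μ] {δ : ℝ} (hδ : 0 < δ) (e : ℕ → ℝ)
    (he0 : e 0 = δ) (hmono : ∀ k, k < n → e k < e (k + 1)) (hn : 0 < n)
    (deg : Fin (L + 1) → ℕ) (hdeg0 : deg 0 = 0)
    (β₀ : ℝ) (b w : Fin n → ℝ) (G : Fin (L + 1) → Fin n → Fin n → ℝ) (R : Fin (L + 1) → μ → Fin n → ℝ)
    (hZ : ∀ v : Fin n → ℝ, 0 ≤ β₀ + 2 * ∑ i, b i * v i + ∑ i, ∑ i', v i * v i' * G 0 i i')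
    (hG : ∀ k, k ≠ 0 → ∀ i i', G k i i' = ∑ m, R k m i * R k m i')
    (hOFF : ∀ i i' : Fin n, ∀ t : ℝ, -1 ≤ t → t ≤ 1 → t ≤ cbar4 δ (e i) (e (i + 1)) (e i') (e (i' + 1)) →
      ∑ k, G k i i' * legPn (deg k) t ≤ 0)
    (S : Fin Q → Finset (Fin n)) (lam m : Fin Q → ℝ) (hlam : ∀ q, 0 ≤ lam q)
    (top : Fin Q → ℕ) (htop : ∀ q, top q ≤ n) (hS : ∀ q i, i ∈ S q → (i : ℕ) < top q)
    (hm : ∀ q, (2 * e (top q) / δ + 1) ^ 3 - 1 ≤ m q)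
    (hDIAG : ∀ i, 2 * b i + ∑ k, G k i i + w i ≤ ∑ q, if i ∈ S q then lam q else 0)
    (φ : ℝ → ℝ) (hw : ∀ i : Fin n, ∀ r, e i ≤ r → r < e (i + 1) → φ r ≤ w i)
    {N : ℕ} {x : Fin N → EuclideanSpace ℝ (Fin 3)} (hx : Sep δ x) (i : Fin N) :
    ∑ j ∈ (Finset.univ.erase i).filter (fun j => dist (x i) (x j) < e n), φ (dist (x i) (x j)) ≤
      β₀ + ∑ q, lam q * m q := by
  classical
  set F := (Finset.univ.erase i).filter (fun j => dist (x i) (x j) < e n) with hF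
  have hmono' := edges_mono hmono
  -- radii of the near points
  have hFd : ∀ j ∈ F, δ ≤ dist (x i) (x j) ∧ dist (x i) (x j) < e n := fun j hj => by
    obtain ⟨hji, hjn⟩ := Finset.mem_filter.1 hj
    exact ⟨hx i j (Finset.ne_of_mem_erase hji).symm, hjn⟩
  -- cell labels
  let c : F → Fin n := fun j => ⟨cellOf e n (dist (x i) (x j)), lt_of_le_of_lt (cellOf_le e n _) (Nat.sub_lt hn one_pos)⟩
  have hc1 : ∀ j : F, e (c j) ≤ dist (x i) (x j) := fun j =>
    edge_cellOf_le (he0 ▸ (hFd j j.2).1)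
  have hc2 : ∀ j : F, dist (x i) (x j) < e ((c j : ℕ) + 1) := fun j =>
    lt_edge_cellOf_succ hn (hFd j j.2).2
  -- unit directions
  let y : F → EuclideanSpace ℝ (Fin 3) := fun j => x j - x i
  have hy : ∀ j : F, ‖y j‖ = dist (x i) (x j) := fun j => by
    simp only [y]; rw [← dist_eq_norm, dist_comm]
  have hy0 : ∀ j : F, y j ≠ 0 := fun j => by
    rw [← norm_ne_zero_iff, hy]; exact (lt_of_lt_of_le hδ (hFd j j.2).1).ne'
  let u : F → EuclideanSpace ℝ (Fin 3) := fun j => (‖y j‖⁻¹) • y j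
  have hu : ∀ j : F, ‖u j‖ = 1 := fun j => norm_unitDir (hy0 j)
  -- the kernels
  let K : Fin (L + 1) → F → F → ℝ := fun k j j' => legPn (deg k) (inner ℝ (u j) (u j'))
  have hK0 : ∀ j j', K 0 j j' = 1 := fun j j' => by simp only [K, hdeg0, legPn_zero]
  have hKdiag : ∀ k j, K k j j = 1 := fun k j => by
    simp only [K]
    rw [inner_self_eq_one_of_norm (hu j), legPn_one]
  have hKpd : ∀ k (a : F → ℝ), 0 ≤ ∑ j, ∑ j', a j * a j' * K k j j' := fun k a => legPn_pd (deg k) u hu a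
  -- OFF
  have hOFF' : ∀ j j' : F, j ≠ j' → ∑ k, G k (c j) (c j') * K k j j' ≤ 0 := by
    intro j j' hjj'
    have hne : (j : Fin N) ≠ j' := fun h => hjj' (Subtype.ext h)
    have hsep : δ ≤ ‖y j - y j'‖ := by
      have : y j - y j' = x j - x j' := by simp only [y]; abel
      rw [this, ← dist_eq_norm]; exact hx j j' hne
    have ht1 : -1 ≤ inner ℝ (u j) (u j') := neg_one_le_inner_unitDir (hy0 j) (hy0 j')
    have ht1' : inner ℝ (u j) (u j') ≤ 1 := by
      have := real_inner_le_norm (u j) (u j'); rw [hu j, hu j', mul_one] at this; exact this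
    have ht2 : inner ℝ (u j) (u j') ≤ cbar4 δ (e (c j)) (e ((c j : ℕ) + 1)) (e (c j')) (e ((c j' : ℕ) + 1)) := by
      refine inner_unitDir_le_cbar4 hδ ?_ ?_ ?_ ?_ ?_ ?_ hsep
      · rw [← he0]; exact hmono' 0 _ (Nat.zero_le _) ((cellOf_le e n _).trans (Nat.sub_le n 1))
      · rw [← he0]; exact hmono' 0 _ (Nat.zero_le _) ((cellOf_le e n _).trans (Nat.sub_le n 1))
      · rw [hy]; exact hc1 j
      · rw [hy]; exact (hc2 j).le
      · rw [hy]; exact hc1 j'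
      · rw [hy]; exact (hc2 j').le
    exact hOFF (c j) (c j') _ ht1 ht1' ht2
  -- counts (ball packing)
  have hcount : ∀ q, (∑ j : F, (if c j ∈ S q then (1 : ℝ) else 0)) ≤ m q := by
    intro q
    have hsub : ∀ j : F, c j ∈ S q → dist (x i) (x j) < e (top q) := fun j hj =>
      lt_of_lt_of_le (hc2 j) (hmono' _ _ (Nat.succ_le_of_lt (hS q (c j) hj)) (htop q))
    have h1 : (∑ j : F, (if c j ∈ S q then (1 : ℝ) else 0)) ≤
        ∑ j : F, (if dist (x i) (x j) < e (top q) then (1 : ℝ) else 0) :=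
      Finset.sum_le_sum fun j _ => by
        by_cases h : c j ∈ S q
        · rw [if_pos h, if_pos (hsub j h)]
        · rw [if_neg h]; split_ifs <;> norm_num
    have h2 : (∑ j : F, (if dist (x i) (x j) < e (top q) then (1 : ℝ) else 0)) =
        (((F.filter fun j => dist (x i) (x j) < e (top q)).card : ℕ) : ℝ) := by
      rw [Finset.card_filter, Nat.cast_sum]
      rw [← Finset.sum_coe_sort F]
      simp
    have h3 : ((F.filter fun j => dist (x i) (x j) < e (top q)).card : ℝ) ≤
        ((((Finset.univ.erase i).filter fun j => dist (x i) (x j) < e (top q)).card : ℕ) : ℝ) := by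
      exact_mod_cast Finset.card_le_card (fun j hj => by
        obtain ⟨hjF, hjt⟩ := Finset.mem_filter.1 hj
        exact Finset.mem_filter.2 ⟨(Finset.mem_filter.1 hjF).1, hjt⟩)
    have h4 := card_near_le hδ hx i (le_of_lt (lt_of_lt_of_le hδ (he0 ▸ hmono' 0 _ (Nat.zero_le _) (htop q))))
      (t := e (top q))
    linarith [hm q]
  -- abstract soundness
  have main := jointCert_sound c K hK0 hKdiag hKpd β₀ b G R hZ hG hOFF' S lam m hlam hcount w hDIAG
  -- compare the radial sum with the cell weights
  calc ∑ j ∈ F, φ (dist (x i) (x j)) = ∑ j : F, φ (dist (x i) (x j)) := (Finset.sum_coe_sort F _).symm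
    _ ≤ ∑ j : F, w (c j) := Finset.sum_le_sum fun j _ => hw (c j) _ (hc1 j) (hc2 j)
    _ ≤ β₀ + ∑ q, lam q * m q := main

end Summit.AtomisticToContinuum.Crystallization.Theorems.StrictSplittingRuleBirth

end
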